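import Summits.ABC.StewartYu.PadicW80ParB
import HarnessLib

/-!
# Cell abc-stewartyu, junction J2: the closed-form sizes of the `p`-adic machine and the two WP-A4 budgets

`Summits/ABC/StewartYu/PadicW80Budgets.lean` — cell `abc-stewartyu` (HOME
`run/shared/lean/pub/abc-stewartyu/`, seat p3; closed-form definitions + theorems over p1's record
`PadicW80Par` only, no named fact).

Closed forms (`E(c) = exp(c·𝔘/(2c_L'))`, `𝔅 = e^{𝔘/64}`): `Efacp`, `PrVp = 2𝔅⁵E(2)`,
`DmaxK k = 𝔅²E(2^{k+1})`, `MmaxK k = 𝔅·PrV·DmaxK k`, `DmaxHp = 𝔅²E(2)`, `MmaxHp = 𝔅·PrV·DmaxHp`, with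
their logarithms (`log_PrVp`, `log_DmaxK_mul_MmaxK`, `log_DmaxHp`, `log_MmaxHp`) and the two WP-A4
BUDGETS `log(DmaxK·MmaxK) ≤ 𝔘/4 + 2ᵏ𝔘/16` (`logDM_le_budget`) and, for the half step,
`2^{d+1}·log(4·DmaxH²·MmaxH·Hprod³) − log DmaxH ≤ (7/16)·2ᵈ𝔘` (`bhalf_le_budget`, for
`1 ≤ Hprod ≤ exp(∑V + V_θ)`).

Everything is [folklore].
-/

noncomputable section

open Finset

namespace Summit.ABC.StewartYu

namespace PadicW80Par

variable {d : ℕ} (P : PadicW80Par d)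

/-! ### Closed forms -/

/-- The height unit `E(c) = exp(c · 𝔘/(2c_L'))`. [folklore] -/
def Efacp (c : ℝ) : ℝ := Real.exp (c * (P.𝔘p / (2 * cLp')))

/-- The coefficient bound `PrV = 2 𝔅⁵ E(2)` (`≥ ⌈#box₀·𝔅⁴E(2)⌉`). [folklore] -/
def PrVp : ℝ := 2 * P.𝔅p ^ 5 * P.Efacp 2

/-- `Dmax_k = 𝔅² E(2^{k+1})` (the clearing denominators of the `k`-th inner step). [folklore] -/
def DmaxK (k : ℕ) : ℝ := P.𝔅p ^ 2 * P.Efacp ((2 ^ (k + 1) : ℕ) : ℝ)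

/-- `Mmax_k = 𝔅 · PrV · Dmax_k` (the archimedean size of the cores of the `k`-th inner step). [folklore] -/
def MmaxK (k : ℕ) : ℝ := P.𝔅p * P.PrVp * P.DmaxK k

/-- `DmaxH = 𝔅² E(2)` (half points). [folklore] -/
def DmaxHp : ℝ := P.𝔅p ^ 2 * P.Efacp 2

/-- `MmaxH = 𝔅 · PrV · DmaxH` (half points). [folklore] -/
def MmaxHp : ℝ := P.𝔅p * P.PrVp * P.DmaxHp

/-- `0 < E(c)`. [folklore] -/
theorem Efacp_pos (c : ℝ) : 0 < P.Efacp c := Real.exp_pos _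

/-- `1 ≤ E(c)` for `c ≥ 0`. [folklore] -/
theorem one_le_Efacp {c : ℝ} (hc : 0 ≤ c) : 1 ≤ P.Efacp c := by
  unfold Efacp; exact Real.one_le_exp (by have := P.𝔘_pos; unfold cLp'; positivity)

/-- `0 < DmaxK`. [folklore] -/
theorem DmaxK_pos (k : ℕ) : 0 < P.DmaxK k := by
  unfold DmaxK; have := P.𝔅_pos; have := P.Efacp_pos ((2 ^ (k + 1) : ℕ) : ℝ); positivity

/-- `1 ≤ PrV`. [folklore] -/
theorem one_le_PrVp : 1 ≤ P.PrVp := by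
  unfold PrVp
  have h1 : 1 ≤ P.𝔅p ^ 5 := one_le_pow₀ P.one_le_𝔅
  have h2 := P.one_le_Efacp (show (0 : ℝ) ≤ 2 by norm_num)
  nlinarith

/-- `0 < MmaxK`. [folklore] -/
theorem MmaxK_pos (k : ℕ) : 0 < P.MmaxK k := by
  unfold MmaxK; have := P.𝔅_pos; have := P.one_le_PrVp; have := P.DmaxK_pos k; positivity

/-- `1 ≤ DmaxH`. [folklore] -/
theorem one_le_DmaxHp : 1 ≤ P.DmaxHp := by
  unfold DmaxHp
  exact one_le_mul_of_one_le_of_one_le (one_le_pow₀ P.one_le_𝔅) (P.one_le_Efacp (by norm_num))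

/-- `1 ≤ MmaxH`. [folklore] -/
theorem one_le_MmaxHp : 1 ≤ P.MmaxHp := by
  unfold MmaxHp
  exact one_le_mul_of_one_le_of_one_le (one_le_mul_of_one_le_of_one_le P.one_le_𝔅 P.one_le_PrVp)
    P.one_le_DmaxHp

/-- `log PrV = log 2 + 5·𝔘/64 + 2·𝔘/(2c_L')`. [folklore] -/
theorem log_PrVp : Real.log P.PrVp = Real.log 2 + 5 * (P.𝔘p / 64) + 2 * (P.𝔘p / (2 * cLp')) := by
  unfold PrVp Efacp 𝔅p
  rw [Real.log_mul (by positivity) (Real.exp_pos _).ne', Real.log_mul (by norm_num) (by positivity),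
    Real.log_pow, Real.log_exp, Real.log_exp]; push_cast; ring

/-- `log(Dmax_k · Mmax_k) = log 2 + 10·𝔘/64 + (2 + 2^{k+2})·𝔘/(2c_L')`. [folklore] -/
theorem log_DmaxK_mul_MmaxK (k : ℕ) : Real.log (P.DmaxK k * P.MmaxK k) =
    Real.log 2 + 10 * (P.𝔘p / 64) + (2 + (2 : ℝ) ^ (k + 2)) * (P.𝔘p / (2 * cLp')) := by
  have h𝔅 := P.𝔅_pos
  have e : P.DmaxK k * P.MmaxK k = 2 * (P.𝔅p ^ 10 * (P.Efacp 2 * P.Efacp ((2 ^ (k + 1) : ℕ) : ℝ) ^ 2)) := by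
    unfold MmaxK PrVp DmaxK; ring
  rw [e, Real.log_mul (by norm_num) (by have := P.Efacp_pos 2; have := P.Efacp_pos ((2 ^ (k + 1) : ℕ) : ℝ); positivity),
    Real.log_mul (by positivity) (by have := P.Efacp_pos 2; have := P.Efacp_pos ((2 ^ (k + 1) : ℕ) : ℝ); positivity),
    Real.log_mul (P.Efacp_pos 2).ne' (by have := P.Efacp_pos ((2 ^ (k + 1) : ℕ) : ℝ); positivity),
    Real.log_pow, Real.log_pow]
  unfold Efacp 𝔅p
  rw [Real.log_exp, Real.log_exp, Real.log_exp]; push_cast; ring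

/-- `log DmaxH = 2·𝔘/64 + 2·𝔘/(2c_L')`. [folklore] -/
theorem log_DmaxHp : Real.log P.DmaxHp = 2 * (P.𝔘p / 64) + 2 * (P.𝔘p / (2 * cLp')) := by
  unfold DmaxHp Efacp 𝔅p
  rw [Real.log_mul (by positivity) (Real.exp_pos _).ne', Real.log_pow, Real.log_exp, Real.log_exp]; ring

/-- `log MmaxH = log 2 + 8·𝔘/64 + 4·𝔘/(2c_L')`. [folklore] -/
theorem log_MmaxHp : Real.log P.MmaxHp = Real.log 2 + 8 * (P.𝔘p / 64) + 4 * (P.𝔘p / (2 * cLp')) := by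
  have h𝔅 := P.𝔅_pos
  have e : P.MmaxHp = 2 * (P.𝔅p ^ 8 * (P.Efacp 2 * P.Efacp 2)) := by unfold MmaxHp PrVp DmaxHp; ring
  rw [e, Real.log_mul (by norm_num) (by have := P.Efacp_pos 2; positivity),
    Real.log_mul (by positivity) (by have := P.Efacp_pos 2; positivity),
    Real.log_mul (P.Efacp_pos 2).ne' (P.Efacp_pos 2).ne', Real.log_pow]
  unfold Efacp 𝔅p
  rw [Real.log_exp, Real.log_exp]; push_cast; ring

/-! ### The two WP-A4 budgets -/

/-- **Budget of the inner steps**: `log(Dmax_k · Mmax_k) ≤ 𝔘/4 + 2ᵏ𝔘/16`. [folklore] -/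
theorem logDM_le_budget (k : ℕ) : Real.log (P.DmaxK k * P.MmaxK k) ≤ P.𝔘p / 4 + 2 ^ k * P.𝔘p / 16 := by
  rw [P.log_DmaxK_mul_MmaxK]
  have hU := P.𝔘_ge'; have hl2 : Real.log 2 ≤ 1 := by linarith [Real.log_two_lt_d9]
  have h2k : (1 : ℝ) ≤ 2 ^ k := one_le_pow₀ (by norm_num)
  have e4 : (2 : ℝ) ^ (k + 2) = 4 * 2 ^ k := by rw [pow_add]; ring
  rw [e4]; unfold cLp'
  nlinarith [show (2 : ℝ) ^ 98 ≥ 2 ^ 20 by norm_num]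

/-- **Budget of the half step**: with `∏H(allᵢ) ≤ exp(∑Vall)` (and `∑Vall ≤ 𝔘/2⁹⁰`),
`2^{d+1}·log(4·DmaxH²·MmaxH·Hprod³) − log DmaxH ≤ (7/16)·2ᵈ·𝔘`. [folklore] -/
theorem bhalf_le_budget {Hprod : ℝ} (hH1 : 1 ≤ Hprod) (hH : Hprod ≤ Real.exp ((∑ j, P.Vs j) + P.Vel)) :
    (2 : ℝ) ^ (d + 1) * Real.log (4 * P.DmaxHp ^ 2 * P.MmaxHp * Hprod ^ 3) - Real.log P.DmaxHp ≤
      7 / 16 * (2 ^ d * P.𝔘p) := by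
  have hD1 := P.one_le_DmaxHp; have hM1 := P.one_le_MmaxHp
  have hlogD : 0 ≤ Real.log P.DmaxHp := Real.log_nonneg hD1
  have hlogH : Real.log Hprod ≤ (∑ j, P.Vs j) + P.Vel := by
    have := Real.log_le_log (by linarith) hH; rwa [Real.log_exp] at this
  have hlogH0 : 0 ≤ Real.log Hprod := Real.log_nonneg hH1
  have hsum := P.sumV_le_𝔘
  have e : Real.log (4 * P.DmaxHp ^ 2 * P.MmaxHp * Hprod ^ 3) =
      Real.log 4 + 2 * Real.log P.DmaxHp + Real.log P.MmaxHp + 3 * Real.log Hprod := by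
    rw [Real.log_mul (by positivity) (by positivity), Real.log_mul (by positivity) (by positivity),
      Real.log_mul (by norm_num) (by positivity), Real.log_pow, Real.log_pow]; push_cast; ring
  rw [e, P.log_MmaxHp]
  rw [P.log_DmaxHp] at hlogD ⊢
  have hl2 : Real.log 2 ≤ 1 := by linarith [Real.log_two_lt_d9]
  have hl4 : Real.log 4 ≤ 2 := by
    rw [show (4 : ℝ) = 2 ^ 2 by norm_num, Real.log_pow]; push_cast; linarith
  have hU := P.𝔘_ge'; have h2d : (1 : ℝ) ≤ 2 ^ d := one_le_pow₀ (by norm_num)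
  unfold cLp' at hlogD ⊢
  -- the bracket is `≤ 0.19·𝔘`, times `2^{d+1}` gives `0.38·2^d·𝔘 ≤ (7/16)·2^d·𝔘`
  have hbr : Real.log 4 + 2 * (2 * (P.𝔘p / 64) + 2 * (P.𝔘p / (2 * 2 ^ 12))) +
      (Real.log 2 + 8 * (P.𝔘p / 64) + 4 * (P.𝔘p / (2 * 2 ^ 12))) + 3 * Real.log Hprod ≤ 7 / 32 * P.𝔘p := by
    nlinarith [show (2 : ℝ) ^ 98 ≥ 2 ^ 95 by norm_num]
  have h2d0 : (0 : ℝ) ≤ 2 ^ (d + 1) := by positivity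
  calc (2 : ℝ) ^ (d + 1) * (Real.log 4 + 2 * (2 * (P.𝔘p / 64) + 2 * (P.𝔘p / (2 * 2 ^ 12))) +
        (Real.log 2 + 8 * (P.𝔘p / 64) + 4 * (P.𝔘p / (2 * 2 ^ 12))) + 3 * Real.log Hprod) -
        (2 * (P.𝔘p / 64) + 2 * (P.𝔘p / (2 * 2 ^ 12)))
      ≤ 2 ^ (d + 1) * (7 / 32 * P.𝔘p) - 0 := by
        gcongr
    _ = 7 / 16 * (2 ^ d * P.𝔘p) := by rw [pow_succ]; ring

end PadicW80Par

end Summit.ABC.StewartYu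

end
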